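import Literature.Computability.QuantumComplexity.OracleGateReplacement
import Literature.Computability.Cryptography.StatisticalDistanceMapProofs
import HarnessLib

/-!
# Replacing oracle gates: output distributions and the query-register marginal (Aaronson–Chen 2017, Cor. 2.5 and proofs of Lemmas 5.3, 8.2)

Topic `Computability/QuantumComplexity` (family `quantum-advantage`). Companion of
`OracleGateReplacement.lean`, which proves the state-vector bound
`‖U^A_C ψ − V_g ψ‖₂ ≤ ∑_t 2 √(q_{D_t}(|v_t⟩))` for a circuit whose oracle gates are replaced one by
one (`replMatrix`, `replQueryWeights`). This file adds the two remaining, purely analytic, steps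
of the printed proofs of S. Aaronson, L. Chen, CCC 2017 (arXiv:1612.05903) [AaronsonChen2017],
Lemma 5.3 (pp. 21–23) and Lemma 8.2 (pp. 32–33), in the tree's model (Q2 circuits, Born rule
`bornPMF` / `QCircuit.outputPMF`, statistical distance `PMF.tvDist`):

* **from states to samples** — Aaronson–Chen Cor. 2.5: "Let `|φ₀⟩` and `|φ₁⟩` be two pure quantum
  state such that `| |φ₀⟩ − |φ₁⟩ | ≤ ε`. … `‖𝒟(φ₀) − 𝒟(φ₁)‖ ≤ √(2ε)`", used as "By Corollary 2.5 …
  the final distribution `𝒟` on which `A` takes samples satisfies `‖𝒟 − 𝒟^M_{x,ε}‖ ≤ …`" (p. 23,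
  p. 33). We prove the sharper linear bound of Bernstein–Vazirani / BBBV Thm. 3.1 for the
  computational-basis measurement, `Δ(Born(a), Born(b)) ≤ ‖a − b‖₂` for unit vectors
  (`tvDist_bornPMF_le_l2Norm`; for `ε ≤ 2` one has `ε ≤ √(2ε)`), and push it through any classical
  post-processing (`PMF.tvDist_map_le_holds`): `tvDist_outputPMF_replOutputPMF_le`,
  `tvDist_map_outputPMF_replOutputPMF_le`, and the uniform forms `… ≤ 2T√ε₁`;
* **the learning target** — "`ρ` is a (mixed) quantum state on the first `2n` bits, and `⟨i|ρ|i⟩`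
  is the probability of seeing `i` when measuring `ρ` in the computational basis. So we can define
  a probability distribution `Q` … `Q(i) := ⟨i|ρ|i⟩`" and the error term is `4 · Pr_{i∼Q}[f(i) ≠ g(i)]`
  (eq. (5) p. 22, eq. (13) p. 32): `queryMarginal e ψ` is the law of the query register of a placed
  oracle gate when the unit vector `ψ` is measured (the push-forward of `bornPMF ψ` under
  `queryOf e`), and `queryWeight_eq_toReal_queryMarginal` identifies the tree's query magnitude
  `q_D(ψ)` (`HybridArgument.lean`) with `Pr_{i∼Q}[i ∈ D]` — so that a PAC-learning guarantee
  "`Pr_{i∼Q_t}[f(i) ≠ g_t(i)] ≤ ε₁`" for samples drawn from `Q_t = queryMarginal e_t |v_t⟩` is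
  exactly the hypothesis of the uniform bound.

All results are `theorem`s (no named facts).

## Design notes

* `bornPMF` is the honest Born distribution of `QuantumCircuit.lean` (normalised, uniform on the
  zero vector); every statement here carries the unit-vector hypothesis under which it is the
  plain `|ψ x|²` law (`bornPMF_apply_of_sum_eq_one`).
* `replOutputPMF g C x` is the law of the full measurement of the replaced circuit run on
  `|x⟩|0^m⟩`, the analogue of `QCircuit.outputPMF A C x`; `T = C.oracleQueries`.

## Sources

* [AaronsonChen2017] arXiv:1612.05903 (read via `lit read arxiv:1612.05903`): Cor. 2.5 (p. 13);
  §5.3 p. 22 (the distribution `Q`, eq. (5)), p. 23 ("By Corollary 2.5 …"); §8 pp. 32–33 (eq. (13),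
  "a `poly(n, ε₁⁻¹, ln δ₁⁻¹)` number of i.i.d. samples from `Q`", "`‖𝒟 − 𝒟^M_{x,ε}‖ ≤ √(2·ε²/8) = ε/2`").
* [BennettBernsteinBrassardVazirani1997] Thm. 3.1 (close unit vectors give close outcome
  statistics), one-event form proved in the tree as `abs_sum_normSq_sub_le` (`HybridArgument.lean`).
* [Goldreich2001] §3.2.1 (statistical distance), as used by the tree's `PMF.tvDist`,
  `PMF.tvDist_map_le_holds`.
-/

noncomputable section

namespace Literature.Computability.QuantumComplexity

open Matrix
open scoped ENNReal

variable {G : Cryptography.QGateSet} {N k : ℕ}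

/-! ### From state vectors to Born distributions -/

/-- `∑ₓ | |a x|² − |b x|² | ≤ 2 ‖a − b‖₂` for unit vectors `a`, `b` (Cauchy–Schwarz on
`| |a|² − |b|² | ≤ |a − b| (|a| + |b|)`). [cite: BennettBernsteinBrassardVazirani1997, Thm. 3.1 (proof)] -/
theorem sum_abs_normSq_sub_le {a b : Cryptography.QReg N → ℂ} (ha : Cryptography.normSq a = 1)
    (hb : Cryptography.normSq b = 1) :
    ∑ x, |‖a x‖ ^ 2 - ‖b x‖ ^ 2| ≤ 2 * l2Norm (a - b) := by
  have hterm : ∀ x, |‖a x‖ ^ 2 - ‖b x‖ ^ 2| ≤ ‖a x - b x‖ * ‖a x‖ + ‖a x - b x‖ * ‖b x‖ := by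
    intro x
    rw [sq_sub_sq, abs_mul, abs_of_nonneg (by positivity : 0 ≤ ‖a x‖ + ‖b x‖)]
    have h : |‖a x‖ - ‖b x‖| ≤ ‖a x - b x‖ := abs_norm_sub_norm_le _ _
    nlinarith [norm_nonneg (a x), norm_nonneg (b x), abs_nonneg (‖a x‖ - ‖b x‖)]
  have hA : ∑ x, ‖a x - b x‖ * ‖a x‖ ≤ l2Norm (a - b) * 1 := by
    refine (sum_mul_le_sqrt_mul_sqrt _ _ _).trans (le_of_eq ?_)
    rw [l2Norm_eq_sqrt_normSq, ← Real.sqrt_one]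
    congr 1
    rw [← ha]
    rfl
  have hB : ∑ x, ‖a x - b x‖ * ‖b x‖ ≤ l2Norm (a - b) * 1 := by
    refine (sum_mul_le_sqrt_mul_sqrt _ _ _).trans (le_of_eq ?_)
    rw [l2Norm_eq_sqrt_normSq, ← Real.sqrt_one]
    congr 1
    rw [← hb]
    rfl
  calc ∑ x, |‖a x‖ ^ 2 - ‖b x‖ ^ 2|
      ≤ ∑ x, (‖a x - b x‖ * ‖a x‖ + ‖a x - b x‖ * ‖b x‖) := Finset.sum_le_sum fun x _ => hterm x
    _ = ∑ x, ‖a x - b x‖ * ‖a x‖ + ∑ x, ‖a x - b x‖ * ‖b x‖ := Finset.sum_add_distrib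
    _ ≤ 2 * l2Norm (a - b) := by linarith

/-- On a unit vector the Born probability of `x`, as a real number, is `|ψ x|²`. [folklore] -/
theorem toReal_bornPMF_apply {ψ : Cryptography.QReg N → ℂ} (hψ : Cryptography.normSq ψ = 1)
    (x : Cryptography.QReg N) : (Cryptography.bornPMF ψ x).toReal = ‖ψ x‖ ^ 2 := by
  rw [Cryptography.bornPMF_apply_of_sum_eq_one hψ, ENNReal.toReal_ofReal (sq_nonneg _)]

/-- **Close unit vectors give close measurement statistics** (Bernstein–Vazirani / BBBV Thm. 3.1,
total-variation form; Aaronson–Chen Cor. 2.5 has `√(2ε)`): for unit vectors `a`, `b` the Born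
distributions of the computational-basis measurement satisfy `Δ(Born(a), Born(b)) ≤ ‖a − b‖₂`.
[cite: BennettBernsteinBrassardVazirani1997, Thm. 3.1] [cite: AaronsonChen2017, Cor. 2.5 (p. 13)] -/
theorem tvDist_bornPMF_le_l2Norm {a b : Cryptography.QReg N → ℂ} (ha : Cryptography.normSq a = 1)
    (hb : Cryptography.normSq b = 1) :
    (Cryptography.bornPMF a).tvDist (Cryptography.bornPMF b) ≤ l2Norm (a - b) := by
  unfold PMF.tvDist
  rw [tsum_fintype]
  simp only [toReal_bornPMF_apply ha, toReal_bornPMF_apply hb]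
  have h := sum_abs_normSq_sub_le ha hb
  linarith

/-! ### The query-register marginal `Q` -/

/-- **The distribution `Q` of the query register** of a placed oracle gate with wires `e` when the
state `ψ` is measured in the computational basis: the push-forward of the Born distribution of `ψ`
under `queryOf e` ("`Q(i) := ⟨i|ρ|i⟩`, the probability of seeing `i` when measuring `ρ`", the
reduced state of the query register). This is the distribution the simulators of Lemma 5.3 and
Lemma 8.2 sample from ("Taking a polynomial number of samples from `Q`", p. 33).
[cite: AaronsonChen2017, §5.3 (proof of Lemma 5.3, the distribution Q, p. 22) and §8 (proof of Lemma 8.2, p. 33)] -/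
def queryMarginal (e : Fin (k + 1) ↪ Fin N) (ψ : Cryptography.QReg N → ℂ) : PMF (List Bool) :=
  (Cryptography.bornPMF ψ).map (Cryptography.queryOf e)

/-- **The query magnitude is the `Q`-probability**: for a unit vector `ψ`,
`q_D(ψ) = Pr_{i∼Q}[i ∈ D]` with `Q = queryMarginal e ψ`; in particular Aaronson–Chen's
`Pr_{i∼Q}[f(i) ≠ g(i)]` is `queryWeight {w | (w ∈ g) ≠ (w ∈ f)} e ψ`.
[cite: AaronsonChen2017, §5.3 (proof of Lemma 5.3, eq. (5), p. 22) and §8 (proof of Lemma 8.2, eq. (13), p. 32)] -/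
theorem queryWeight_eq_toReal_queryMarginal {ψ : Cryptography.QReg N → ℂ} (hψ : Cryptography.normSq ψ = 1)
    (D : Set (List Bool)) (e : Fin (k + 1) ↪ Fin N) :
    queryWeight D e ψ = ((queryMarginal e ψ).toOuterMeasure D).toReal := by
  classical
  rw [queryMarginal, PMF.toOuterMeasure_map_apply, PMF.toOuterMeasure_apply, tsum_fintype]
  have hterm : ∀ x : Cryptography.QReg N,
      (Cryptography.queryOf e ⁻¹' D).indicator (Cryptography.bornPMF ψ) x =
        ENNReal.ofReal (if Cryptography.queryOf e x ∈ D then ‖ψ x‖ ^ 2 else 0) := fun x => by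
    rw [Set.indicator_apply, Set.mem_preimage]
    split_ifs with h
    · rw [Cryptography.bornPMF_apply_of_sum_eq_one hψ]
    · simp
  rw [Finset.sum_congr rfl fun x _ => hterm x, ← ENNReal.ofReal_sum_of_nonneg fun x _ => by
    split_ifs <;> positivity, ENNReal.toReal_ofReal (Finset.sum_nonneg fun x _ => by
    split_ifs <;> positivity)]
  unfold queryWeight
  exact Finset.sum_congr rfl fun x _ => by congr

/-- The `Q`-probability of any set is at most `1` (so the hypothesis "`Pr_{i∼Q}[…] ≤ ε₁`" is only
binding for `ε₁ < 1`). [folklore] -/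
theorem toReal_queryMarginal_le_one (e : Fin (k + 1) ↪ Fin N) (ψ : Cryptography.QReg N → ℂ)
    (D : Set (List Bool)) : ((queryMarginal e ψ).toOuterMeasure D).toReal ≤ 1 :=
  ENNReal.toReal_le_of_le_ofReal zero_le_one <| by
    rw [ENNReal.ofReal_one]
    exact ((queryMarginal e ψ).toOuterMeasure_mono (fun _ _ => Set.mem_univ _)).trans_eq
      (((queryMarginal e ψ).toOuterMeasure_apply_eq_one_iff Set.univ).2 (Set.subset_univ _))

/-! ### Output distributions of the replaced circuit -/

variable {n m : ℕ}

/-- The output distribution of the REPLACED circuit run on `|x⟩|0^m⟩` and measured on all wires: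
the Born distribution of `V_g |x 0^m⟩` — the distribution the simulator finally samples from
("It first takes a sample `z` by measuring `V|0⟩^{⊗N}` in the computational basis", p. 33); the
analogue of `QCircuit.outputPMF A C x` for `replMatrix`.
[cite: AaronsonChen2017, §8 (proof of Lemma 8.2, "Our classical algorithm A then simulates stages 2 and 3", p. 33)] -/
def replOutputPMF (g : ℕ → Language Bool) (C : Cryptography.QCircuit G (n + m)) (x : Cryptography.QReg n) :
    PMF (Cryptography.QReg (n + m)) :=
  Cryptography.bornPMF (replMatrix g 0 C.gates *ᵥ Cryptography.basisState (Cryptography.padInput x m))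

/-- With every replacement equal to the oracle itself the replaced output law is the plain one.
[folklore] -/
theorem replOutputPMF_const (A : Language Bool) (C : Cryptography.QCircuit G (n + m)) (x : Cryptography.QReg n) :
    replOutputPMF (fun _ => A) C x = C.outputPMF A x := by
  rw [replOutputPMF, replMatrix_const]
  rfl

/-- **Output distributions move by at most `∑_t 2√(q_{D_t}(|v_t⟩))`**: over a unitary gate set, if
each `g t` agrees with `A` outside `D t`, the measured output laws of the circuit with oracle `A`
and of the replaced circuit, both run on `|x⟩|0^m⟩`, are within that statistical distance
(state bound `l2Norm_toMatrix_sub_replMatrix_le` and `tvDist_bornPMF_le_l2Norm`).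
[cite: AaronsonChen2017, §5.3 (proof of Lemma 5.3, "Analysis of the final circuit", p. 23) and §8 (proof of Lemma 8.2, p. 33)] -/
theorem tvDist_outputPMF_replOutputPMF_le (hG : G.IsUnitary) {A : Language Bool}
    {g : ℕ → Language Bool} {D : ℕ → Set (List Bool)}
    (hD : ∀ t w, w ∉ D t → (w ∈ g t ↔ w ∈ A)) (C : Cryptography.QCircuit G (n + m)) (x : Cryptography.QReg n) :
    (C.outputPMF A x).tvDist (replOutputPMF g C x) ≤
      ((replQueryWeights g D 0 C.gates (Cryptography.basisState (Cryptography.padInput x m))).map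
        fun q => 2 * Real.sqrt q).sum := by
  have hU : Cryptography.normSq (C.toMatrix A *ᵥ Cryptography.basisState (Cryptography.padInput x m)) = 1 :=
    Cryptography.QCircuit.normSq_runOn_basisState hG A C x
  have hV : Cryptography.normSq (replMatrix g 0 C.gates *ᵥ Cryptography.basisState (Cryptography.padInput x m)) = 1 := by
    rw [normSq_replMatrix_mulVec hG, Cryptography.normSq_basisState]
  refine (tvDist_bornPMF_le_l2Norm hU hV).trans ?_
  exact l2Norm_toMatrix_sub_replMatrix_le hG hD 0 C.gates _

/-- The same after any classical post-processing `f` of the measured string (e.g. `List.ofFn`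
followed by the `SampBQP` algorithm's output routine `A^output`): statistical distance does not
increase (`PMF.tvDist_map_le_holds`). [cite: AaronsonChen2017, §8 (proof of Lemma 8.2, "and then outputs A^output(z) as its sample", p. 33)] -/
theorem tvDist_map_outputPMF_replOutputPMF_le (hG : G.IsUnitary) {A : Language Bool}
    {g : ℕ → Language Bool} {D : ℕ → Set (List Bool)}
    (hD : ∀ t w, w ∉ D t → (w ∈ g t ↔ w ∈ A)) (C : Cryptography.QCircuit G (n + m)) (x : Cryptography.QReg n)
    {β : Type} (f : Cryptography.QReg (n + m) → β) :
    ((C.outputPMF A x).map f).tvDist ((replOutputPMF g C x).map f) ≤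
      ((replQueryWeights g D 0 C.gates (Cryptography.basisState (Cryptography.padInput x m))).map
        fun q => 2 * Real.sqrt q).sum :=
  (PMF.tvDist_map_le_holds f _ _).trans (tvDist_outputPMF_replOutputPMF_le hG hD C x)

/-- **Uniform form** ("with probability at least `1 − T·δ₁` … `‖U|0⟩ − V|0⟩‖ ≤ 2T·√ε₁`", then
Cor. 2.5): if along the replaced run every oracle gate's disagreement set has `Q_t`-probability at
most `ε₁`, the post-processed output laws are within statistical distance `2 · T · √ε₁`, `T` the
number of oracle gates of `C`. [cite: AaronsonChen2017, §8 (proof of Lemma 8.2, p. 33)] -/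
theorem tvDist_map_outputPMF_replOutputPMF_le_of_forall_le (hG : G.IsUnitary) {A : Language Bool}
    {g : ℕ → Language Bool} {D : ℕ → Set (List Bool)}
    (hD : ∀ t w, w ∉ D t → (w ∈ g t ↔ w ∈ A)) (C : Cryptography.QCircuit G (n + m)) (x : Cryptography.QReg n)
    {β : Type} (f : Cryptography.QReg (n + m) → β) {ε₁ : ℝ}
    (hε : ∀ q ∈ replQueryWeights g D 0 C.gates (Cryptography.basisState (Cryptography.padInput x m)), q ≤ ε₁) :
    ((C.outputPMF A x).map f).tvDist ((replOutputPMF g C x).map f) ≤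
      2 * (C.oracleQueries : ℝ) * Real.sqrt ε₁ := by
  refine (tvDist_map_outputPMF_replOutputPMF_le hG hD C x f).trans ?_
  rw [← length_replQueryWeights g D 0 C.gates (Cryptography.basisState (Cryptography.padInput x m))]
  exact sum_map_two_mul_sqrt_le_of_forall_le hε

/-- Aaronson–Chen's numbers: with `ε₁ = ε⁴/(256 T²)` (`T ≥ 1`) the post-processed output laws are
within `ε²/8` (they continue "`≤ √(2 · ε²/8) = ε/2`" through Cor. 2.5; the linear bound gives
`ε²/8` outright). [cite: AaronsonChen2017, §8 (proof of Lemma 8.2, δ₁ = ε/2T, ε₁ = ε⁴/256T², p. 33)] -/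
theorem tvDist_map_outputPMF_replOutputPMF_le_sq_div_eight (hG : G.IsUnitary) {A : Language Bool}
    {g : ℕ → Language Bool} {D : ℕ → Set (List Bool)}
    (hD : ∀ t w, w ∉ D t → (w ∈ g t ↔ w ∈ A)) (C : Cryptography.QCircuit G (n + m)) (x : Cryptography.QReg n)
    {β : Type} (f : Cryptography.QReg (n + m) → β) (ε : ℝ) (hT : 0 < C.oracleQueries)
    (hq : ∀ q ∈ replQueryWeights g D 0 C.gates (Cryptography.basisState (Cryptography.padInput x m)),
      q ≤ ε ^ 4 / (256 * (C.oracleQueries : ℝ) ^ 2)) :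
    ((C.outputPMF A x).map f).tvDist ((replOutputPMF g C x).map f) ≤ ε ^ 2 / 8 := by
  rw [← two_mul_mul_sqrt_eq (T := (C.oracleQueries : ℝ)) (Nat.cast_pos.2 hT) ε]
  exact tvDist_map_outputPMF_replOutputPMF_le_of_forall_le hG hD C x f hq

/-! ### Circuit families: the kernel of the replaced run -/

/-- The classical input/output kernel of the replaced circuit of a family on input `x` (replacement
languages `g`, all wires measured, bit string output), the analogue of `QCircuitFamily.kernel`.
[cite: AaronsonChen2017, §8 (proof of Lemma 8.2, p. 33)] -/
def replKernel (g : ℕ → Language Bool) (F : Cryptography.QCircuitFamily G) (x : List Bool) : PMF (List Bool) :=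
  (replOutputPMF g (F.circ x.length) x.get).map List.ofFn

/-- **The sampling-level statement used by Lemma 8.2**: for a family `F` over a unitary gate set,
an oracle `A`, an input `x` and any post-processing `post`, if along the replaced run of
`F.circ |x|` on `|x⟩|0…0⟩` every oracle gate's disagreement set `D t` (outside which `g t` agrees
with `A`) has `Q_t`-probability at most `ε₁`, then the post-processed kernels of the `A`-run and
of the replaced run are within statistical distance `2 · T · √ε₁`.
[cite: AaronsonChen2017, §8 (proof of Lemma 8.2, "Hence, the outputted distribution … satisfies ‖𝒟^A − 𝒟^M‖ ≤ ε", p. 33)] -/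
theorem tvDist_kernel_replKernel_le_of_forall_le (hG : G.IsUnitary) {A : Language Bool}
    {g : ℕ → Language Bool} {D : ℕ → Set (List Bool)}
    (hD : ∀ t w, w ∉ D t → (w ∈ g t ↔ w ∈ A)) (F : Cryptography.QCircuitFamily G) (x : List Bool)
    (post : List Bool → List Bool) {ε₁ : ℝ}
    (hε : ∀ q ∈ replQueryWeights g D 0 (F.circ x.length).gates
      (Cryptography.basisState (Cryptography.padInput x.get (F.ancillas x.length))), q ≤ ε₁) :
    ((F.kernel A x).map post).tvDist ((replKernel g F x).map post) ≤
      2 * ((F.circ x.length).oracleQueries : ℝ) * Real.sqrt ε₁ := by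
  rw [Cryptography.QCircuitFamily.kernel, replKernel, PMF.map_comp, PMF.map_comp]
  exact tvDist_map_outputPMF_replOutputPMF_le_of_forall_le hG hD _ _ (post ∘ List.ofFn) hε

end Literature.Computability.QuantumComplexity

end
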